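import Literature.Analysis.FluidPDE.KNSSTypeIRateCompactnessProofs
import Literature.Analysis.FluidPDE.KNSSOseenMildDecayOfLemma31
import Literature.Analysis.FluidPDE.KNSSWeakDriftMildProofs
import HarnessLib

/-!
# KNSS 2009, Lemma 6.1 for the doubly rescaled sequence: discharge of
# `KNSS2009_typeI_rate_compactness`

Analysis/FluidPDE proof file (sibling of `KNSSTypeIRateCore.lean`) discharging the named fact
`Literature.Analysis.FluidPDE.KNSS2009_typeI_rate_compactness` (Koch–Nadirashvili–Seregin–Šverák,
*Liouville theorems for the Navier–Stokes equations and applications*, Acta Math. 203 (2009)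
83–105 = arXiv:0709.3599, Lemma 6.1, p. 11, as used in the proof of Theorem 6.2, p. 13: "Since the
functions `w⁽ᵏ⁾` are mild solutions of the Navier–Stokes equations in `(A_k, 0)` …, in view of
bound (wkbound3) we can choose a subsequence of the sequence `w⁽ᵏ⁾` … such that the `w⁽ᵏ⁾`
converge uniformly on compact subsets of `ℝ³ × (−∞, 0)` to an ancient mild solution `w`"):

* `KNSS2009_typeI_rate_compactness_holds : KNSS2009_typeI_rate_compactness`, unconditionally,

by composing the three proved layers of the tree:

1. `KNSS2009_typeI_rate_compactness_of_oseenMild` (`KNSSTypeIRateCompactnessProofs.lean`) — the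
   compactness (equicontinuity of bounded solutions of the Oseen equation, diagonal Arzelà–Ascoli,
   dominated convergence in the integral equation) from the mildness of the `w⁽ᵏ⁾`;
2. `KNSS2009_oseenMild_of_cylRadius_decay_of_weak_driftMild` (`KNSSOseenMildDecayOfLemma31.lean`)
   — the mildness clause of Theorem 6.1 (bounded classical solutions with the horizontal decay
   (6.4) satisfy the Oseen integral equation: "It follows easily that `b` must vanish and therefore
   `u` is a mild solution", p. 12) from Lemma 3.1 in drift-mild form;
3. `KNSS2009_weak_driftMild_holds` (`KNSSWeakDriftMildProofs.lean`) — Lemma 3.1 itself.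

With the glue of `KNSSTypeIRateCoreProofs.lean` the vendored Theorem 6.2
(`KNSS2009_regularity_typeI_rate`) now depends only on Theorem 6.1
(`KNSS2009_regularity_bound_C_over_r`), the Liouville step (`KNSS2009_typeI_rate_liouville`) and
the vertex estimate (`KNSS2009_typeI_rate_vertex`):
`KNSS2009_regularity_typeI_rate_of_liouville_of_vertex`.

## References

* G. Koch, N. Nadirashvili, G. Seregin, V. Šverák, Acta Math. 203 (2009) 83–105 =
  arXiv:0709.3599: Lemma 3.1 (p. 7), Lemma 6.1 (p. 11), Thm. 6.1 and its proof (pp. 11–12),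
  Thm. 6.2 and its proof (pp. 12–13). [KochNadirashviliSereginSverak2009]
-/

noncomputable section

namespace Literature.Analysis.FluidPDE

/-- **KNSS 2009, Lemma 6.1 for the doubly rescaled sequence of the proof of Theorem 6.2 —
discharged**: the compactness fact `KNSS2009_typeI_rate_compactness` holds, by
`KNSS2009_typeI_rate_compactness_of_oseenMild` (compactness from mildness),
`KNSS2009_oseenMild_of_cylRadius_decay_of_weak_driftMild` (mildness clause of Theorem 6.1 from
Lemma 3.1) and `KNSS2009_weak_driftMild_holds` (Lemma 3.1). [cite: KochNadirashviliSereginSverak2009, Lemma 6.1 (arXiv p. 11) and proof of Thm 6.2 (p. 13), with Thm 6.1 (pp. 11–12) and Lemma 3.1 (p. 7)] -/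
theorem KNSS2009_typeI_rate_compactness_holds : KNSS2009_typeI_rate_compactness :=
  KNSS2009_typeI_rate_compactness_of_oseenMild
    (KNSS2009_oseenMild_of_cylRadius_decay_of_weak_driftMild KNSS2009_weak_driftMild_holds)

/-- **KNSS 2009, Theorem 6.2 as vendored, from Theorem 6.1, the Liouville step and the vertex
estimate** — the compactness ingredient of Steps 5–6 of its proof being discharged
(`KNSS2009_typeI_rate_compactness_holds`). [cite: KochNadirashviliSereginSverak2009, Thm 6.2 and its proof (arXiv pp. 12–13)] -/
theorem KNSS2009_regularity_typeI_rate_of_liouville_of_vertex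
    (h61 : KNSS2009_regularity_bound_C_over_r) (h2 : KNSS2009_typeI_rate_liouville)
    (h3 : KNSS2009_typeI_rate_vertex) : KNSS2009_regularity_typeI_rate :=
  KNSS2009_regularity_typeI_rate_of_core h61 KNSS2009_typeI_rate_compactness_holds h2 h3

end Literature.Analysis.FluidPDE

end
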